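import Summits.ValiantsHypothesis.ValiantsHypothesis.Theorems.SymPencilPerFourHessianColControl
import Literature.Computability.AlgebraicComplexity.AlperBogartVelascoBoxThree

/-!
# Route `SymPencil` — two-row spaces with vanishing `2 × 2` subpermanents inside three columns
# (a primitive for Cases B3/C of Task T1 of `Cruxes/SdcSuperquadratic/NEXT-RUNG-23.md`;
# `--supports` stmt-ValiantsHypothesis-5674 `SdcSuperquadratic`)

* `finrank_le_three_of_three_cells`: a subspace of `4 × 4` matrices whose elements are determined
  by three cells has dimension `≤ 3`.
* `finrank_le_three_of_two_rows_perm`: a subspace `U` supported in two rows `b, c` and in the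
  columns `≠ m₁`, on which the three `2 × 2` subpermanents of these rows (columns `≠ m₁`) vanish,
  has `dim U ≤ 3`.  (Polarise the subpermanents against an element with a non-zero row `b`: the
  row-`c` part of `U ∩ {row b = 0}` is then at most a line, and is `0` when row `b` of `U` is all
  of `K³`.)

Honest framing: linear-algebra primitives towards `sdc(per_4) ≥ 25`; nothing here changes
`sdc(per_4) ≥ 23`; the crux stays open; `VP ≠ VNP` is not moved. [folklore]
-/

noncomputable section

-- single-conjunct layout: Sub = Summit, duplicated namespace component intended
set_option linter.dupNamespace false

namespace Summit.ValiantsHypothesis.ValiantsHypothesis.Theorems.SymPencilPerFourTwoRowsPerm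

open Matrix Finset Module
open Literature.Computability.AlgebraicComplexity.AlperBogartVelasco
open Summit.ValiantsHypothesis.ValiantsHypothesis.Theorems.SymPencilPerFourHessianMinors

variable {K : Type*} [Field K]

/-- A subspace of `4 × 4` matrices whose elements are determined by three cells has dimension
`≤ 3`. [folklore] -/
theorem finrank_le_three_of_three_cells (U : Submodule K (Fin 4 × Fin 4 → K))
    (p₁ p₂ p₃ : Fin 4 × Fin 4)
    (h : ∀ x ∈ U, x p₁ = 0 → x p₂ = 0 → x p₃ = 0 → x = 0) : finrank K U ≤ 3 := by
  classical
  let f : (Fin 4 × Fin 4 → K) →ₗ[K] (Fin 3 → K) :=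
    LinearMap.pi fun i => LinearMap.proj (![p₁, p₂, p₃] i)
  have hf : ∀ x i, f x i = x (![p₁, p₂, p₃] i) := fun _ _ => rfl
  have hker : LinearMap.ker (f.domRestrict U) = ⊥ := by
    rw [Submodule.eq_bot_iff]
    intro x hx
    rw [LinearMap.mem_ker, LinearMap.domRestrict_apply] at hx
    have h1 : (x : Fin 4 × Fin 4 → K) p₁ = 0 := by
      have := congr_fun hx 0; rwa [hf] at this
    have h2 : (x : Fin 4 × Fin 4 → K) p₂ = 0 := by
      have := congr_fun hx 1; rwa [hf] at this
    have h3 : (x : Fin 4 × Fin 4 → K) p₃ = 0 := by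
      have := congr_fun hx 2; rwa [hf] at this
    exact Subtype.ext (h x x.2 h1 h2 h3)
  have h1 := LinearMap.finrank_range_add_finrank_ker (f.domRestrict U)
  rw [hker, finrank_bot, add_zero] at h1
  have h2 := Submodule.finrank_le (LinearMap.range (f.domRestrict U))
  rw [Module.finrank_fintype_fun_eq_card, Fintype.card_fin] at h2
  omega

/-- For three distinct columns of `Fin 4`, the columns `≠ m₁` are exactly the images of `0, 1, 2`
under `Equiv.swap 3 m₁`. [folklore] -/
theorem eq_swap_of_ne (m₁ j : Fin 4) (hj : j ≠ m₁) :
    j = Equiv.swap 3 m₁ 0 ∨ j = Equiv.swap 3 m₁ 1 ∨ j = Equiv.swap 3 m₁ 2 := by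
  revert m₁ j
  decide

/-- `Equiv.swap 3 m₁` moves `0, 1, 2` away from `m₁`. [folklore] -/
theorem swap_ne (m₁ : Fin 4) (i : Fin 4) (hi : i ≠ 3) : Equiv.swap 3 m₁ i ≠ m₁ := by
  intro h
  by_cases him : i = m₁
  · rw [him, Equiv.swap_apply_right] at h
    exact hi (him.trans h.symm)
  · rw [Equiv.swap_apply_of_ne_of_ne hi him] at h
    exact him h

/-- **Two rows with vanishing `2 × 2` subpermanents inside three columns: `dim ≤ 3`.**  See the
module docstring. [folklore] -/
theorem finrank_le_three_of_two_rows_perm (U : Submodule K (Fin 4 × Fin 4 → K)) (b c m₁ : Fin 4)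
    (hsupp : ∀ x ∈ U, ∀ p : Fin 4 × Fin 4, (p.1 ≠ b ∧ p.1 ≠ c) ∨ p.2 = m₁ → x p = 0)
    (hperm : ∀ x ∈ U, ∀ j l : Fin 4, j ≠ l → x (b, j) * x (c, l) + x (b, l) * x (c, j) = 0) :
    finrank K U ≤ 3 := by
  classical
  set τ : Equiv.Perm (Fin 4) := Equiv.swap 3 m₁ with hτ
  have hτne : ∀ i : Fin 4, i ≠ 3 → τ i ≠ m₁ := fun i hi => swap_ne m₁ i hi
  have n01 : τ 0 ≠ τ 1 := fun h => by have := τ.injective h; exact absurd this (by decide)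
  have n02 : τ 0 ≠ τ 2 := fun h => by have := τ.injective h; exact absurd this (by decide)
  have n12 : τ 1 ≠ τ 2 := fun h => by have := τ.injective h; exact absurd this (by decide)
  -- polarisation of the subpermanents
  have hpol : ∀ z ∈ U, ∀ x ∈ U, ∀ j l : Fin 4, j ≠ l →
      z (b, j) * x (c, l) + x (b, j) * z (c, l) + z (b, l) * x (c, j) + x (b, l) * z (c, j) = 0 := by
    intro z hz x hx j l hjl
    have h0 := hperm z hz j l hjl
    have h1 := hperm x hx j l hjl
    have h2 := hperm (z + x) (U.add_mem hz hx) j l hjl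
    simp only [Pi.add_apply] at h2
    linear_combination h2 - h0 - h1
  -- an element with row `b` zero is determined by rows... by its row `c` on the columns `τ 0, τ 1, τ 2`
  have hzero_of : ∀ x ∈ U, (∀ j, x (b, j) = 0) → x (c, τ 0) = 0 → x (c, τ 1) = 0 →
      x (c, τ 2) = 0 → x = 0 := by
    intro x hx hb h0 h1 h2
    funext p
    obtain ⟨i, j⟩ := p
    rw [Pi.zero_apply]
    by_cases hjm : j = m₁
    · exact hsupp x hx (i, j) (Or.inr hjm)
    by_cases hib : i = b
    · rw [hib]; exact hb j
    by_cases hic : i = c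
    · rw [hic]
      rcases eq_swap_of_ne m₁ j hjm with h | h | h <;> rw [h]
      · exact h0
      · exact h1
      · exact h2
    · exact hsupp x hx (i, j) (Or.inl ⟨hib, hic⟩)
  by_cases hb0 : ∀ x ∈ U, ∀ j, x (b, j) = 0
  · -- `U` lives in row `c`: three cells
    exact finrank_le_three_of_three_cells U (c, τ 0) (c, τ 1) (c, τ 2)
      fun x hx h0 h1 h2 => hzero_of x hx (hb0 x hx) h0 h1 h2
  push Not at hb0
  obtain ⟨z, hz, p, hzp⟩ := hb0
  have hpm : p ≠ m₁ := fun h => hzp (hsupp z hz (b, p) (Or.inr h))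
  -- the row-`b` map and `U₀ = U ∩ {row b = 0}`
  let ρ : (Fin 4 × Fin 4 → K) →ₗ[K] (Fin 4 → K) := LinearMap.funLeft K K fun j : Fin 4 => (b, j)
  have hρ : ∀ x j, ρ x j = x (b, j) := fun _ _ => rfl
  set U₀ : Submodule K (Fin 4 × Fin 4 → K) := U ⊓ LinearMap.ker ρ with hU₀
  have memU₀ : ∀ x, x ∈ U₀ ↔ x ∈ U ∧ ∀ j, x (b, j) = 0 := fun x => by
    rw [hU₀, Submodule.mem_inf, LinearMap.mem_ker]
    exact ⟨fun h => ⟨h.1, fun j => by have := congr_fun h.2 j; rwa [hρ] at this⟩,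
      fun h => ⟨h.1, funext fun j => h.2 j⟩⟩
  -- on `U₀`, row `c` is determined by its entry at column `p`
  have hdet : ∀ x ∈ U₀, x (c, p) = 0 → x = 0 := by
    intro x hx hxp
    obtain ⟨hxU, hxb⟩ := (memU₀ x).1 hx
    have hcq : ∀ q, q ≠ p → x (c, q) = 0 := by
      intro q hqp
      have h := hpol z hz x hxU p q (Ne.symm hqp)
      simp only [hxb, hxp, zero_mul, mul_zero, add_zero] at h
      exact (mul_eq_zero.1 h).resolve_left hzp
    have hall : ∀ q, x (c, q) = 0 := fun q => by
      by_cases hqp : q = p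
      · rw [hqp]; exact hxp
      · exact hcq q hqp
    exact hzero_of x hxU hxb (hall _) (hall _) (hall _)
  have hU₀le : finrank K U₀ ≤ 1 := by
    let g : (Fin 4 × Fin 4 → K) →ₗ[K] K := LinearMap.proj (c, p)
    have hker : LinearMap.ker (g.domRestrict U₀) = ⊥ := by
      rw [Submodule.eq_bot_iff]
      intro x hx
      rw [LinearMap.mem_ker, LinearMap.domRestrict_apply] at hx
      exact Subtype.ext (hdet x x.2 hx)
    have h1 := LinearMap.finrank_range_add_finrank_ker (g.domRestrict U₀)
    rw [hker, finrank_bot, add_zero] at h1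
    have h2 := Submodule.finrank_le (LinearMap.range (g.domRestrict U₀))
    rw [Module.finrank_self] at h2
    omega
  -- the image of row `b` lies in `{v_{m₁} = 0}` (rank `≤ 3`)
  have himage : U.map ρ ≤ LinearMap.ker (LinearMap.proj m₁ : (Fin 4 → K) →ₗ[K] K) := by
    rintro _ ⟨x, hx, rfl⟩
    rw [LinearMap.mem_ker, LinearMap.proj_apply, hρ]
    exact hsupp x hx (b, m₁) (Or.inr rfl)
  have hk3 : finrank K (LinearMap.ker (LinearMap.proj m₁ : (Fin 4 → K) →ₗ[K] K)) = 3 := by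
    have hsurj : Function.Surjective (LinearMap.proj m₁ : (Fin 4 → K) →ₗ[K] K) :=
      fun t => ⟨Pi.single m₁ t, by simp⟩
    have h := LinearMap.finrank_range_add_finrank_ker (LinearMap.proj m₁ : (Fin 4 → K) →ₗ[K] K)
    rw [LinearMap.range_eq_top.2 hsurj, finrank_top, Module.finrank_self,
      Module.finrank_fintype_fun_eq_card, Fintype.card_fin] at h
    omega
  have hdim := finrank_eq_finrank_map_add_finrank_inf_ker U ρ
  rw [← hU₀] at hdim
  by_cases h3 : finrank K (U.map ρ) ≤ 2
  · omega
  · -- row `b` of `U` is all of `{v_{m₁} = 0}`; then `U₀ = 0`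
    have heq : U.map ρ = LinearMap.ker (LinearMap.proj m₁ : (Fin 4 → K) →ₗ[K] K) :=
      Submodule.eq_of_le_of_finrank_le himage (by omega)
    -- realise row `b = e_p + e_q` for the two columns `q ≠ p, m₁`
    have hreal : ∀ v : Fin 4 → K, v m₁ = 0 → ∃ x ∈ U, ∀ j, x (b, j) = v j := by
      intro v hv
      have : v ∈ U.map ρ := by rw [heq, LinearMap.mem_ker, LinearMap.proj_apply]; exact hv
      obtain ⟨x, hx, hxv⟩ := this
      exact ⟨x, hx, fun j => by have := congr_fun hxv j; rwa [hρ] at this⟩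
    have hU₀bot : ∀ x ∈ U₀, x = 0 := by
      intro x hx
      obtain ⟨hxU, hxb⟩ := (memU₀ x).1 hx
      apply hdet x hx
      -- use `z₁` with row `b = e_p + e_q` and `z₂` with row `b = e_p + e_s`
      obtain ⟨q, s, hqp, hsp, hqs, hqm, hsm⟩ : ∃ q s : Fin 4, q ≠ p ∧ s ≠ p ∧ q ≠ s ∧ q ≠ m₁ ∧
          s ≠ m₁ := by
        have key : ∀ p m₁ : Fin 4, p ≠ m₁ → ∃ q s : Fin 4, q ≠ p ∧ s ≠ p ∧ q ≠ s ∧ q ≠ m₁ ∧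
            s ≠ m₁ := by decide
        exact key p m₁ hpm
      obtain ⟨z₁, hz₁, hz₁v⟩ := hreal (Pi.single p 1 + Pi.single q 1) (by
        rw [Pi.add_apply, Pi.single_eq_of_ne (Ne.symm hpm), Pi.single_eq_of_ne (Ne.symm hqm),
          add_zero])
      obtain ⟨z₂, hz₂, hz₂v⟩ := hreal (Pi.single p 1 + Pi.single s 1) (by
        rw [Pi.add_apply, Pi.single_eq_of_ne (Ne.symm hpm), Pi.single_eq_of_ne (Ne.symm hsm),
          add_zero])
      have e1p : z₁ (b, p) = 1 := by
        rw [hz₁v, Pi.add_apply, Pi.single_eq_same, Pi.single_eq_of_ne (Ne.symm hqp), add_zero]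
      have e1q : z₁ (b, q) = 1 := by
        rw [hz₁v, Pi.add_apply, Pi.single_eq_of_ne hqp, Pi.single_eq_same, zero_add]
      have e1s : z₁ (b, s) = 0 := by
        rw [hz₁v, Pi.add_apply, Pi.single_eq_of_ne hsp, Pi.single_eq_of_ne (Ne.symm hqs),
          add_zero]
      have e2p : z₂ (b, p) = 1 := by
        rw [hz₂v, Pi.add_apply, Pi.single_eq_same, Pi.single_eq_of_ne (Ne.symm hsp), add_zero]
      have e2s : z₂ (b, s) = 1 := by
        rw [hz₂v, Pi.add_apply, Pi.single_eq_of_ne hsp, Pi.single_eq_same, zero_add]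
      -- `(p, s)` with `z₁`: `x_{c s} = 0`; `(p, q)` with `z₁`: `x_{c q} + x_{c p} = 0`;
      -- `(p, s)` with `z₂`: `x_{c s} + x_{c p} = 0`
      have a1 := hpol z₁ hz₁ x hxU p s hsp.symm
      have a2 := hpol z₁ hz₁ x hxU p q hqp.symm
      have a3 := hpol z₂ hz₂ x hxU p s hsp.symm
      rw [hxb p, hxb s, e1p, e1s] at a1
      rw [hxb p, hxb q, e1p, e1q] at a2
      rw [hxb p, hxb s, e2p, e2s] at a3
      simp only [one_mul, zero_mul, add_zero] at a1 a2 a3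
      linear_combination a3 - a1
    have hU₀0 : finrank K U₀ = 0 := by
      have hbot : U₀ = ⊥ := (Submodule.eq_bot_iff _).2 hU₀bot
      rw [hbot, finrank_bot]
    have hle : finrank K (U.map ρ) ≤ 3 := by rw [heq, hk3]
    omega

end Summit.ValiantsHypothesis.ValiantsHypothesis.Theorems.SymPencilPerFourTwoRowsPerm

end
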